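import Summits.QuantumFields.YangMills.Theorems.BalabanLadderIRLightCodeTraceCluster
import Summits.QuantumFields.YangMills.Theorems.BalabanLadderIRLightCodePincerDefs
import Summits.QuantumFields.YangMills.Theorems.PencilRigidityWeakCouplingHypercubicLimitStubRateBookkeeping
import Summits.QuantumFields.YangMills.Theses.BalabanLadder
import Literature.MathematicalPhysics.QuantumLattice.WilsonBlockHeatBathLightCone2
import HarnessLib

/-!
# Route `BalabanLadder`, crux `IR` (stmt-QuantumFields-19354): flux-code blindness — the lattice seams and `IR` BY NAME

The kernel-checked reduction of the crux-idea card `Cruxes/IR/Ideas/ym19354-5-flux-code-blindness.md` (seat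
`ym-cruxidea-19354-5` gen 3; `Sketch-g3.lean` rev 3 sha16 `c463f541daed4b01`, evidence #48 on stmt-QuantumFields-19354),
landed per route-owner ruling R34 (ym-beyond-p2 g25, 2026-08-27) `--supports stmt-QuantumFields-19354` (helper; no
registered stub of 19354 is claimed — the slot of record is `af-pincer-T`):

  `IR_of_lightCodePincer : LightCodePincerInputs → Summit.QuantumFields.YangMills.Theses.BalabanLadder.IR`

for EVERY compact simple `G` (simply connected or not; `q`-level light multiplet).  CONDITIONAL on the open engine-level
bundle `LightCodePincerInputs` (`BalabanLadderIRLightCodePincerDefs`); nothing is discharged; not a gap claim.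

* §1 `volumeFloor_eventually` (`u³e^{−u} → 0`); `abs_latticeConnectedCorr_le_of_lightCodeAt` — LIGHT CODE FORCES
  CLUSTERING at fixed `β` with an explicit β-free constant
  `max((Q+1) C_A C_B e^{2w}·7 + 3 (Q+1)² (C_A + C_B + 1)) (2 C_A C_B e^{2w}) · e^{−μ n}` (the `q`-level trace clustering
  `stub_codeTraceCluster` on the `δ`-representing models + the landed `stub_rateBookkeeping` for the six sector-excess terms
  + the a-priori bound `WilsonBlockHeatBath.abs_latticeConnectedCorr_le_two_mul` in the short range).
* §2 `pinned_of_AF` — the pincer with ANY length function (af-pincer's `onset_pinned` shape: `LowerBounds`(i) + asymptotic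
  freedom below `ℓ(β)` ⇒ `a β · ℓ(β) < T` eventually); `gapInUnits_of_lightCode_pinned` — the rate seam (certificate at rate
  `1/ξ(β) ≥ a β/T` ⇒ `GapInUnits G r a` with `c₁ = 1/T`; the model clauses are monotone in the rate).
* §3 `IR_of_lightCodePincer` — the composition, `IR` BY NAME.

Refs: card (tree); Osterwalder–Seiler, Ann. Phys. 110 (1978) §§2–3; the `q = 0` twin
`Theorems/PencilRigidityWeakCouplingHypercubicLimitColdPressureClustering.lean` (`abs_latticeConnectedCorr_le_of_coldPressure`).
-/

set_option autoImplicit false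

noncomputable section

open Filter Topology MeasureTheory
open scoped BigOperators InnerProductSpace SchwartzMap
open Literature.MathematicalPhysics.QuantumFieldTheory Literature.MathematicalPhysics.QuantumLattice
open Summit.QuantumFields.YangMills.Cruxes.OSLegsFromFemtoAndGap.DlrCollarTransfer (GapInUnits LowerBounds Q2)
open Summit.QuantumFields.YangMills.Theorems.WeakCouplingHypercubicLimit.TraceNormColdPressure
  (stub_rateBookkeeping)

namespace Summit.QuantumFields.YangMills.Cruxes.IR.FluxCodeBlindness

/-! ## §1–§2 The lattice seams -/

section Lattice

variable {G : Type} [Group G] [TopologicalSpace G] [IsTopologicalGroup G] [CompactSpace G]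
  [MeasurableSpace G] [BorelSpace G]

/-- **The volume floor is eventually free at any positive rate** (`u³ e^{−u} → 0`). [folklore] -/
theorem volumeFloor_eventually (C₀ μ : ℝ) (hC₀ : 0 ≤ C₀) (hμ : 0 < μ) :
    ∀ᶠ S : ℕ in atTop, C₀ * ((2 * S + 1 : ℕ) : ℝ) ^ 3 * Real.exp (-(μ * S / 2)) ≤ 1 := by
  have hu : Tendsto (fun S : ℕ => μ * (S : ℝ) / 2) atTop atTop := by
    have h1 : Tendsto (fun S : ℕ => (S : ℝ)) atTop atTop := tendsto_natCast_atTop_atTop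
    have h2 : Tendsto (fun S : ℕ => (S : ℝ) * (μ / 2)) atTop atTop :=
      h1.atTop_mul_const (by positivity)
    refine h2.congr fun S => ?_
    ring
  have h3 := (Real.tendsto_pow_mul_exp_neg_atTop_nhds_zero 3).comp hu
  have h4 : Tendsto (fun S : ℕ => C₀ * 27 * (2 / μ) ^ 3 * ((μ * (S : ℝ) / 2) ^ 3 * Real.exp (-(μ * S / 2))))
      atTop (𝓝 (C₀ * 27 * (2 / μ) ^ 3 * 0)) := h3.const_mul _
  rw [mul_zero] at h4
  have h5 : ∀ᶠ S : ℕ in atTop,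
      C₀ * 27 * (2 / μ) ^ 3 * ((μ * (S : ℝ) / 2) ^ 3 * Real.exp (-(μ * S / 2))) ≤ 1 :=
    h4.eventually (ge_mem_nhds one_pos)
  filter_upwards [h5, eventually_ge_atTop 1] with S hS hS1
  have hcube : ((2 * S + 1 : ℕ) : ℝ) ^ 3 ≤ 27 * (2 / μ) ^ 3 * (μ * (S : ℝ) / 2) ^ 3 := by
    have hid : 27 * (2 / μ) ^ 3 * (μ * (S : ℝ) / 2) ^ 3 = (3 * (S : ℝ)) ^ 3 := by
      field_simp
      ring
    rw [hid]
    have hS1R : (1 : ℝ) ≤ S := by exact_mod_cast hS1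
    have hle : ((2 * S + 1 : ℕ) : ℝ) ≤ 3 * (S : ℝ) := by push_cast; linarith
    exact pow_le_pow_left₀ (by positivity) hle 3
  calc C₀ * ((2 * S + 1 : ℕ) : ℝ) ^ 3 * Real.exp (-(μ * S / 2))
      ≤ C₀ * (27 * (2 / μ) ^ 3 * (μ * (S : ℝ) / 2) ^ 3) * Real.exp (-(μ * S / 2)) := by gcongr
    _ = C₀ * 27 * (2 / μ) ^ 3 * ((μ * (S : ℝ) / 2) ^ 3 * Real.exp (-(μ * S / 2))) := by ring
    _ ≤ 1 := hS

/-- **Light code forces clustering — fixed coupling, explicit β-free constant (PROVED).**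
At `β`, a rate `μ ∈ [0,1]`, `C₀ ≥ 0`, a size threshold `L` past the volume floor `C₀ (2S+1)³ e^{−μS/2} ≤ 1`, and light-code
models (rank `≤ Q`, width `w`) for the pair `(A, B)` give
`|⟨A; τ_n B⟩_{β,(2S+1)⁴}| ≤ max((Q+1) C_A C_B e^{2w}·7 + 3 (Q+1)² (C_A + C_B + 1)) (2 C_A C_B e^{2w}) · e^{−μ n}`. -/
theorem abs_latticeConnectedCorr_le_of_lightCodeAt (r : LatticeRep G) (A B : YMSpecies G) {CA CB : ℝ}
    (hCA : ∀ U, |A.F U| ≤ CA) (hCB : ∀ U, |B.F U| ≤ CB) {β : ℝ} {Q w L : ℕ} {μ C₀ : ℝ}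
    (hμ0 : 0 ≤ μ) (hμ1 : μ ≤ 1) (hC₀ : 0 ≤ C₀)
    (hK : ∀ S : ℕ, L ≤ S → C₀ * ((2 * S + 1 : ℕ) : ℝ) ^ 3 * Real.exp (-(μ * S / 2)) ≤ 1)
    (hmod : ∀ S n : ℕ, L ≤ S → n ≤ S → w < n → 2 * w ≤ S → ∀ δ : ℝ, 0 < δ →
      ∃ (d q : ℕ) (T Ao Bo : Euc d →L[ℝ] Euc d) (e : Fin (q + 1) → Euc d) (θ : Fin (q + 1) → ℝ),
        q ≤ Q ∧ LightCodeModel T Ao Bo e θ (Real.exp (-μ)) (Real.exp (-(μ * S))) w ∧ ‖Ao‖ ≤ CA ∧ ‖Bo‖ ≤ CB ∧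
        (∀ m : ℕ, S + 1 ≤ 2 * m → secExcess T θ m ≤ C₀ * ((2 * S + 1 : ℕ) : ℝ) ^ 3 * Real.exp (-(μ * m))) ∧
        |latticeConnectedCorr r.ρ β (2 * S + 1) A.F B.F n - modelCorr T Ao Bo S n w| ≤ δ) :
    ∀ S n : ℕ, L ≤ S → n ≤ S →
      |latticeConnectedCorr r.ρ β (2 * S + 1) A.F B.F n| ≤
        max (((Q + 1 : ℕ) : ℝ) * (CA * CB * Real.exp (2 * w) * 7) + 3 * ((Q + 1 : ℕ) : ℝ) ^ 2 * (CA + CB + 1))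
            (2 * (CA * CB) * Real.exp (2 * w)) * Real.exp (-(μ * n)) := by
  have hCA0 : 0 ≤ CA := le_trans (abs_nonneg _) (hCA 1)
  have hCB0 : 0 ≤ CB := le_trans (abs_nonneg _) (hCB 1)
  intro S n hS hn
  have hexp0 : 0 ≤ Real.exp (-(μ * n)) := Real.exp_nonneg _
  by_cases hcase : w < n ∧ 2 * w ≤ S
  · -- light-code models
    set V : ℝ := ((2 * S + 1 : ℕ) : ℝ) ^ 3 with hVdef
    have hV : 0 < V := by positivity
    -- the δ-free bound
    have key : |latticeConnectedCorr r.ρ β (2 * S + 1) A.F B.F n| ≤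
        ((Q + 1 : ℕ) : ℝ) * (CA * CB * Real.exp (2 * w) * 7) * Real.exp (-(μ * n)) +
          3 * ((Q + 1 : ℕ) : ℝ) ^ 2 * (CA + CB + 1) * Real.exp (-(μ * n)) := by
      refine le_of_forall_pos_le_add fun δ hδ => ?_
      obtain ⟨d, q, T, Ao, Bo, e, θ, hqQ, hM, hAo, hBo, hXb', hclose⟩ := hmod S n hS hn hcase.1 hcase.2 δ hδ
      -- sector excess function, total and nonnegative
      set X : ℕ → ℝ := fun m => max 0 (secExcess T θ m) with hXdef
      have hX0 : ∀ m, 0 ≤ X m := fun m => le_max_left _ _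
      have hXb : ∀ m : ℕ, S + 1 ≤ 2 * m → X m ≤ C₀ * V * Real.exp (-(μ * m)) := by
        intro m hm
        exact max_le (by positivity) (hXb' m hm)
      -- the q-level trace cluster bound on the model
      have htc := stub_codeTraceCluster d q T Ao Bo e θ (Real.exp (-μ)) (Real.exp (-(μ * S)))
        (X (2 * S + 1 - n - w)) (X (2 * S + 1)) (X (2 * S + 1 - w)) S n w hM (Real.exp_nonneg _)
        (Real.exp_le_one_iff.mpr (by linarith)) (Real.exp_nonneg _) hcase.1 hn hcase.2
        (le_max_right _ _) (le_max_right _ _) (le_max_right _ _)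
      -- the six landed terms
      have hbr0 : 0 ≤ Real.exp (-μ) ^ (n - w) * (1 + X (2 * S + 1 - n - w)) +
          Real.exp (-μ) ^ (2 * S + 1 - n - w) + X (2 * S + 1) + X (2 * S + 1 - w) + X (2 * S + 1 - w) +
          X (2 * S + 1 - w) * X (2 * S + 1 - w) := by
        have := hX0 (2 * S + 1 - n - w); have := hX0 (2 * S + 1); have := hX0 (2 * S + 1 - w)
        positivity
      have hnorm : ‖Ao‖ * ‖Bo‖ ≤ CA * CB := mul_le_mul hAo hBo (norm_nonneg _) hCA0
      have hsix : ‖Ao‖ * ‖Bo‖ * (Real.exp (-μ) ^ (n - w) * (1 + X (2 * S + 1 - n - w)) +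
          Real.exp (-μ) ^ (2 * S + 1 - n - w) + X (2 * S + 1) + X (2 * S + 1 - w) + X (2 * S + 1 - w) +
          X (2 * S + 1 - w) * X (2 * S + 1 - w)) ≤ CA * CB * Real.exp (2 * w) * 7 * Real.exp (-(μ * n)) := by
        refine (mul_le_mul_of_nonneg_right hnorm hbr0).trans ?_
        have h7 := stub_rateBookkeeping μ C₀ V 1 CA CB X S n w hμ0 hμ1 hCA0 hCB0 hcase.1.le hn hcase.2 hX0 hXb
          (hK S hS)
        have e7 : (2 + 4 * (1 : ℝ) + 1 ^ 2) = 7 := by norm_num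
        rw [e7] at h7
        exact h7
      have hq1 : ((q + 1 : ℕ) : ℝ) ≤ ((Q + 1 : ℕ) : ℝ) := by exact_mod_cast Nat.succ_le_succ hqQ
      have hq0 : (0 : ℝ) ≤ ((q + 1 : ℕ) : ℝ) := Nat.cast_nonneg _
      have hpart1 : ((q + 1 : ℕ) : ℝ) * (‖Ao‖ * ‖Bo‖ * (Real.exp (-μ) ^ (n - w) * (1 + X (2 * S + 1 - n - w)) +
          Real.exp (-μ) ^ (2 * S + 1 - n - w) + X (2 * S + 1) + X (2 * S + 1 - w) + X (2 * S + 1 - w) +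
          X (2 * S + 1 - w) * X (2 * S + 1 - w))) ≤
          ((Q + 1 : ℕ) : ℝ) * (CA * CB * Real.exp (2 * w) * 7) * Real.exp (-(μ * n)) := by
        have hrhs0 : 0 ≤ CA * CB * Real.exp (2 * w) * 7 * Real.exp (-(μ * n)) := by positivity
        calc ((q + 1 : ℕ) : ℝ) * _ ≤ ((q + 1 : ℕ) : ℝ) * (CA * CB * Real.exp (2 * w) * 7 * Real.exp (-(μ * n))) :=
              mul_le_mul_of_nonneg_left hsix hq0
          _ ≤ ((Q + 1 : ℕ) : ℝ) * (CA * CB * Real.exp (2 * w) * 7 * Real.exp (-(μ * n))) :=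
              mul_le_mul_of_nonneg_right hq1 hrhs0
          _ = _ := by ring
      -- the code term
      have hXp1 : X (2 * S + 1 - w) ≤ 1 := by
        have hm : S + 1 ≤ 2 * (2 * S + 1 - w) := by omega
        refine (hXb _ hm).trans (le_trans ?_ (hK S hS))
        have hC₀V : 0 ≤ C₀ * V := by positivity
        refine mul_le_mul_of_nonneg_left (Real.exp_le_exp.2 ?_) hC₀V
        have hpw : (S : ℝ) / 2 ≤ ((2 * S + 1 - w : ℕ) : ℝ) := by
          have : S ≤ 2 * (2 * S + 1 - w) := by omega
          have h' : ((S : ℕ) : ℝ) ≤ ((2 * (2 * S + 1 - w) : ℕ) : ℝ) := by exact_mod_cast this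
          push_cast at h'
          linarith
        nlinarith
      have hε1 : Real.exp (-(μ * S)) ≤ 1 := Real.exp_le_one_iff.mpr (by nlinarith [Nat.cast_nonneg (α := ℝ) S])
      have hε0 : 0 ≤ Real.exp (-(μ * S)) := Real.exp_nonneg _
      have hεn : Real.exp (-(μ * S)) ≤ Real.exp (-(μ * n)) := by
        refine Real.exp_le_exp.2 ?_
        have : (n : ℝ) ≤ S := by exact_mod_cast hn
        nlinarith
      have hcode1 : ‖Ao‖ * Real.exp (-(μ * S)) + ‖Bo‖ * Real.exp (-(μ * S)) +
          Real.exp (-(μ * S)) * Real.exp (-(μ * S)) ≤ (CA + CB + 1) * Real.exp (-(μ * n)) := by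
        have hsq : Real.exp (-(μ * S)) * Real.exp (-(μ * S)) ≤ 1 * Real.exp (-(μ * S)) :=
          mul_le_mul_of_nonneg_right hε1 hε0
        have hA' : ‖Ao‖ * Real.exp (-(μ * S)) ≤ CA * Real.exp (-(μ * S)) := mul_le_mul_of_nonneg_right hAo hε0
        have hB' : ‖Bo‖ * Real.exp (-(μ * S)) ≤ CB * Real.exp (-(μ * S)) := mul_le_mul_of_nonneg_right hBo hε0
        have hsum : (CA + CB + 1) * Real.exp (-(μ * S)) ≤ (CA + CB + 1) * Real.exp (-(μ * n)) :=
          mul_le_mul_of_nonneg_left hεn (by positivity)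
        linarith
      have hpart2 : ((q + 1 : ℕ) : ℝ) ^ 2 * (2 + X (2 * S + 1 - w)) *
          (‖Ao‖ * Real.exp (-(μ * S)) + ‖Bo‖ * Real.exp (-(μ * S)) + Real.exp (-(μ * S)) * Real.exp (-(μ * S))) ≤
          3 * ((Q + 1 : ℕ) : ℝ) ^ 2 * (CA + CB + 1) * Real.exp (-(μ * n)) := by
        have hsq : ((q + 1 : ℕ) : ℝ) ^ 2 ≤ ((Q + 1 : ℕ) : ℝ) ^ 2 := pow_le_pow_left₀ hq0 hq1 2
        have h3 : 2 + X (2 * S + 1 - w) ≤ 3 := by linarith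
        have h30 : 0 ≤ 2 + X (2 * S + 1 - w) := by linarith [hX0 (2 * S + 1 - w)]
        have hc0 : 0 ≤ ‖Ao‖ * Real.exp (-(μ * S)) + ‖Bo‖ * Real.exp (-(μ * S)) +
            Real.exp (-(μ * S)) * Real.exp (-(μ * S)) := by positivity
        calc ((q + 1 : ℕ) : ℝ) ^ 2 * (2 + X (2 * S + 1 - w)) *
              (‖Ao‖ * Real.exp (-(μ * S)) + ‖Bo‖ * Real.exp (-(μ * S)) + Real.exp (-(μ * S)) * Real.exp (-(μ * S)))
            ≤ ((Q + 1 : ℕ) : ℝ) ^ 2 * 3 * ((CA + CB + 1) * Real.exp (-(μ * n))) := by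
              gcongr
          _ = _ := by ring
      have hmodel : |modelCorr T Ao Bo S n w| ≤
          ((Q + 1 : ℕ) : ℝ) * (CA * CB * Real.exp (2 * w) * 7) * Real.exp (-(μ * n)) +
            3 * ((Q + 1 : ℕ) : ℝ) ^ 2 * (CA + CB + 1) * Real.exp (-(μ * n)) :=
        htc.trans (add_le_add hpart1 hpart2)
      have htri := abs_sub_abs_le_abs_sub (latticeConnectedCorr r.ρ β (2 * S + 1) A.F B.F n) (modelCorr T Ao Bo S n w)
      linarith
    calc |latticeConnectedCorr r.ρ β (2 * S + 1) A.F B.F n|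
        ≤ _ := key
      _ = (((Q + 1 : ℕ) : ℝ) * (CA * CB * Real.exp (2 * w) * 7) + 3 * ((Q + 1 : ℕ) : ℝ) ^ 2 * (CA + CB + 1)) *
            Real.exp (-(μ * n)) := by ring
      _ ≤ _ := mul_le_mul_of_nonneg_right (le_max_left _ _) hexp0
  · -- a priori bound
    have hap := WilsonBlockHeatBath.abs_latticeConnectedCorr_le_two_mul r β (2 * S + 1) hCA hCB n
    have hμn : μ * n ≤ 2 * w := by
      have hn2 : (n : ℝ) ≤ 2 * w := by
        rcases not_and_or.mp hcase with h | h
        · have : n ≤ w := Nat.le_of_not_lt h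
          exact_mod_cast (by omega : n ≤ 2 * w)
        · have : S < 2 * w := Nat.lt_of_not_le h
          exact_mod_cast (by omega : n ≤ 2 * w)
      calc μ * n ≤ 1 * n := mul_le_mul_of_nonneg_right hμ1 (Nat.cast_nonneg _)
        _ = n := one_mul _
        _ ≤ 2 * w := hn2
    have hone : 1 ≤ Real.exp (2 * w) * Real.exp (-(μ * n)) := by
      rw [← Real.exp_add]
      exact Real.one_le_exp (by linarith)
    have hCC : 0 ≤ 2 * (CA * CB) := by positivity
    calc |latticeConnectedCorr r.ρ β (2 * S + 1) A.F B.F n|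
        ≤ 2 * (CA * CB) := hap
      _ ≤ 2 * (CA * CB) * (Real.exp (2 * w) * Real.exp (-(μ * n))) :=
          le_mul_of_one_le_right hCC hone
      _ = 2 * (CA * CB) * Real.exp (2 * w) * Real.exp (-(μ * n)) := by ring
      _ ≤ _ := mul_le_mul_of_nonneg_right (le_max_right _ _) hexp0

/-- **The pincer with ANY length function (PROVED; af-pincer's `onset_pinned` ∕ gen 2's `cp_pinned` verbatim).**
`LowerBounds`(i) + asymptotic freedom up to `ℓ(β)` lattice sites per unit length ⇒ `a β · ℓ(β) < T` eventually. -/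
theorem pinned_of_AF (r : LatticeRep G) (a : ℝ → ℝ) (ha : ∀ β, 0 < a β) (hlb : LowerBounds G r a) (ℓ : ℝ → ℕ)
    (hX : ∀ v : 𝓢(EuclideanSpace ℝ (Fin 4), ℝ), tsupport v ⊆ {y : EuclideanSpace ℝ (Fin 4) | 0 < y 0} →
      ∀ η : ℝ, 0 < η → ∃ T β₁ : ℝ, ∀ β : ℝ, β₁ ≤ β → ∀ s : ℝ, 0 < s →
        T ≤ s * (ℓ β : ℝ) → ∃ᶠ (L : ℕ) in atTop, |Q2 G r β L s (thetaTest 4 v) v| ≤ η) :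
    ∃ T β₆ : ℝ, ∀ β : ℝ, β₆ ≤ β → a β * (ℓ β : ℝ) < T := by
  obtain ⟨⟨v, ε₅, β₅, Λ₅, hv, hε₅, hlow⟩, -⟩ := hlb
  obtain ⟨T, β₁, hT⟩ := hX v hv (ε₅ / 2) (half_pos hε₅)
  refine ⟨T, max β₁ β₅, fun β hβ => ?_⟩
  have hβ1 : β₁ ≤ β := le_trans (le_max_left _ _) hβ
  have hβ5 : β₅ ≤ β := le_trans (le_max_right _ _) hβ
  by_contra hge
  rw [not_lt] at hge
  have hfreq := hT β hβ1 (a β) (ha β) hge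
  have hev : ∀ᶠ (L : ℕ) in atTop, Λ₅ ≤ a β * (L : ℝ) :=
    (tendsto_natCast_atTop_atTop.const_mul_atTop (ha β)).eventually_ge_atTop Λ₅
  obtain ⟨L, hL1, hL2⟩ := (hfreq.and_eventually hev).exists
  have hlo := hlow β hβ5 L hL2
  have habs := le_abs_self (Q2 G r β L (a β) (thetaTest 4 v) v)
  linarith

/-- **The rate seam (PROVED): a light-code onset pinned below `T` lattice-units-per-unit
gives `GapInUnits`.**  Per `β` past the thresholds the certificate holds at rate `1/ξ(β) ≥ a β/T =: μ(β)` (`≤ 1` once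
`a β ≤ T`), so also at rate `μ(β)` (the model clauses are monotone in the rate); the volume floor is eventually free; the
constant of `abs_latticeConnectedCorr_le_of_lightCodeAt` sees neither `β` nor `C₀(β)`: `GapInUnits G r a` with `c₁ = 1/T`. -/
theorem gapInUnits_of_lightCode_pinned (r : LatticeRep G) (a : ℝ → ℝ) (ha : ∀ β, 0 < a β)
    (ha0 : Tendsto a atTop (𝓝 0)) {Q : ℕ} {wd : YMSpecies G → YMSpecies G → ℕ} {ξ : ℝ → ℕ} {β₂ : ℝ}
    (hon : ∀ β : ℝ, β₂ ≤ β → 1 ≤ ξ β ∧ LightCodeCertificateAt r β Q (1 / (ξ β : ℝ)) wd)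
    {T β₆ : ℝ} (hpin : ∀ β : ℝ, β₆ ≤ β → a β * (ξ β : ℝ) < T) :
    GapInUnits G r a := by
  classical
  -- `T > 0`
  have hT : 0 < T := by
    have h1 := hpin (max β₂ β₆) (le_max_right _ _)
    have h0 : 0 ≤ a (max β₂ β₆) * (ξ (max β₂ β₆) : ℝ) := mul_nonneg (ha _).le (Nat.cast_nonneg _)
    linarith
  -- eventually `a β ≤ T`
  obtain ⟨β₇, hβ₇⟩ : ∃ β₇ : ℝ, ∀ β : ℝ, β₇ ≤ β → a β ≤ T := by
    have hev : ∀ᶠ β in atTop, a β < T := ha0.eventually (gt_mem_nhds hT)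
    obtain ⟨β₇, h⟩ := Filter.eventually_atTop.1 hev
    exact ⟨β₇, fun β hβ => (h β hβ).le⟩
  set β₈ : ℝ := max (max β₂ β₆) (max β₇ 0) with hβ₈
  -- the per-β package at the uniform rate `a β / T`: models at the LARGER rate `1/ξ β` are models at rate `a β / T`
  have hR : ∀ β : ℝ, β₈ ≤ β → ∃ S₂ : ℕ, ∃ C₀ : ℝ, 0 ≤ C₀ ∧
      (∀ S : ℕ, S₂ ≤ S → C₀ * ((2 * S + 1 : ℕ) : ℝ) ^ 3 * Real.exp (-(a β / T * S / 2)) ≤ 1) ∧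
      (∀ (A B : YMSpecies G) (CA CB : ℝ), (∀ U, |A.F U| ≤ CA) → (∀ U, |B.F U| ≤ CB) →
        ∀ S n : ℕ, S₂ ≤ S → n ≤ S → wd A B < n → 2 * wd A B ≤ S → ∀ δ : ℝ, 0 < δ →
        ∃ (d q : ℕ) (T' Ao Bo : Euc d →L[ℝ] Euc d) (e : Fin (q + 1) → Euc d) (θ : Fin (q + 1) → ℝ),
          q ≤ Q ∧ LightCodeModel T' Ao Bo e θ (Real.exp (-(a β / T))) (Real.exp (-(a β / T * S))) (wd A B) ∧
          ‖Ao‖ ≤ CA ∧ ‖Bo‖ ≤ CB ∧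
          (∀ m : ℕ, S + 1 ≤ 2 * m → secExcess T' θ m ≤ C₀ * ((2 * S + 1 : ℕ) : ℝ) ^ 3 * Real.exp (-(a β / T * m))) ∧
          |latticeConnectedCorr r.ρ β (2 * S + 1) A.F B.F n - modelCorr T' Ao Bo S n (wd A B)| ≤ δ) := by
    intro β hβ
    have hβ2 : β₂ ≤ β := le_trans (le_trans (le_max_left _ _) (le_max_left _ _)) hβ
    have hβ6 : β₆ ≤ β := le_trans (le_trans (le_max_right _ _) (le_max_left _ _)) hβ
    obtain ⟨hξ1, C₀, hC₀, L, hL⟩ := hon β hβ2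
    have hμ0 : 0 < a β / T := div_pos (ha β) hT
    obtain ⟨S₀, hS₀⟩ := Filter.eventually_atTop.1 (volumeFloor_eventually C₀ (a β / T) hC₀ hμ0)
    -- rate comparison `a β / T ≤ 1 / ξ β`
    have hξpos : (0 : ℝ) < (ξ β : ℝ) := by exact_mod_cast hξ1
    have hrate : a β / T ≤ 1 / (ξ β : ℝ) := by
      rw [div_le_div_iff₀ hT hξpos]
      have := hpin β hβ6
      linarith
    refine ⟨max L S₀, C₀, hC₀, fun S hS => hS₀ S (le_trans (le_max_right _ _) hS), ?_⟩
    intro A B CA CB hCA hCB S n hS hn hwn h2w δ hδ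
    obtain ⟨d, q, T', Ao, Bo, e, θ, hqQ, hM, hAo, hBo, hXb, hclose⟩ :=
      hL A B CA CB hCA hCB S n (le_trans (le_max_left _ _) hS) hn hwn h2w δ hδ
    refine ⟨d, q, T', Ao, Bo, e, θ, hqQ, ?_, hAo, hBo, ?_, hclose⟩
    · -- monotonicity of the model clauses in the rate
      obtain ⟨hT', he, heig, hθ0, hθ, hcon, hcA, hcB⟩ := hM
      have hρ : Real.exp (-(1 / (ξ β : ℝ))) ≤ Real.exp (-(a β / T)) := Real.exp_le_exp.2 (by linarith)
      have hε : Real.exp (-(1 / (ξ β : ℝ) * S)) ≤ Real.exp (-(a β / T * S)) :=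
        Real.exp_le_exp.2 (by nlinarith [Nat.cast_nonneg (α := ℝ) S])
      refine ⟨hT', he, heig, hθ0, hθ, fun v hv => (hcon v hv).trans ?_, fun k l => (hcA k l).trans hε,
        fun k l => (hcB k l).trans hε⟩
      exact mul_le_mul_of_nonneg_right hρ (norm_nonneg _)
    · intro m hm
      refine (hXb m hm).trans ?_
      have hV : 0 ≤ C₀ * ((2 * S + 1 : ℕ) : ℝ) ^ 3 := by positivity
      refine mul_le_mul_of_nonneg_left (Real.exp_le_exp.2 ?_) hV
      nlinarith [Nat.cast_nonneg (α := ℝ) m]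
  -- the size threshold `S₁ β` (junk `0` below `β₈`)
  let S₁ : ℝ → ℕ := fun β => if h : β₈ ≤ β then Classical.choose (hR β h) else 0
  refine ⟨1 / T, β₈, S₁, by positivity, fun A B => ?_⟩
  obtain ⟨CA, hCA⟩ := A.bounded
  obtain ⟨CB, hCB⟩ := B.bounded
  set w : ℕ := wd A B with hwdef
  refine ⟨max (((Q + 1 : ℕ) : ℝ) * (CA * CB * Real.exp (2 * w) * 7) + 3 * ((Q + 1 : ℕ) : ℝ) ^ 2 * (CA + CB + 1))
      (2 * (CA * CB) * Real.exp (2 * w)), fun β hβ S n hS hn => ?_⟩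
  have hS₁ : S₁ β = Classical.choose (hR β hβ) := dif_pos hβ
  obtain ⟨C₀, hC₀, hK, hP⟩ := Classical.choose_spec (hR β hβ)
  rw [hS₁] at hS
  have hβ7 : β₇ ≤ β := le_trans (le_trans (le_max_left _ _) (le_max_right _ _)) hβ
  have hμ0 : 0 ≤ a β / T := (div_pos (ha β) hT).le
  have hμ1 : a β / T ≤ 1 := by
    rw [div_le_one hT]
    exact hβ₇ β hβ7
  have hmain := abs_latticeConnectedCorr_le_of_lightCodeAt r A B hCA hCB (β := β) (Q := Q) (w := w) hμ0 hμ1 hC₀ hK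
    (fun S n hS hn hwn h2w δ hδ => hP A B CA CB hCA hCB S n hS hn hwn h2w δ hδ) S n hS hn
  have hexp : Real.exp (-(a β / T * n)) = Real.exp (-(1 / T * a β * n)) := by
    congr 1
    ring
  rw [hexp] at hmain
  exact hmain

end Lattice

/-! ## §3 The composition to `IR` BY NAME -/

/-- **Composition: `IR` BY NAME from the light-code pincer inputs** (every compact simple `G`; CONDITIONAL on the open bundle `LightCodePincerInputs`; `pinned_of_AF` ⊕ `gapInUnits_of_lightCode_pinned`). -/
theorem IR_of_lightCodePincer (h : LightCodePincerInputs) :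
    Summit.QuantumFields.YangMills.Theses.BalabanLadder.IR := by
  intro G _ _ _ _ hG
  letI : MeasurableSpace G := borel G
  haveI : BorelSpace G := ⟨rfl⟩
  intro r a ha ha0 hlb
  obtain ⟨Q, wd, ξ, β₂, hon, hX⟩ := h G hG r
  obtain ⟨T, β₆, hpin⟩ := pinned_of_AF r a ha hlb ξ hX
  exact gapInUnits_of_lightCode_pinned r a ha ha0 hon hpin

end Summit.QuantumFields.YangMills.Cruxes.IR.FluxCodeBlindness

end
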